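import Summits.RiemannHypothesis.RiemannHypothesis.Theorems.LagariasZeroFreeDoorStripPL
import Literature.NumberTheory.LFunctions.RiemannXiOrderProofs
import Literature.NumberTheory.LFunctions.SuzukiWeilNormIdentityProofs
import HarnessLib

/-!
# The tree's typed input `StripMaxPrinciple` of `Theorems/LagariasZeroFreeDoor.lean` is a THEOREM; the Lagarias zero-free door needs ONE
# textbook input (`MinModulusCircles`) instead of two (part 2/2; RH-free)

Cell rh-split, seat rh-split-dbr-neg g6 (brief sha16 f79c5f09d8bcb036), card `run/shared/lean/pub/rh-split/cards/SPLIT-dbr-neg.md` §14;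
carve of `HOME/rh-split-dbr-neg/SketchG6.lean` (sha16 081103008145d3f5, ns `…Scratch.SplitDbrNegG6`) filed by rh-split-typer-1 g4 in two parts
(400-line rule): `LagariasZeroFreeDoorStripPL` (Part A, pure complex analysis) and `LagariasZeroFreeDoorStrip` (Part B).  Proofs verbatim.

Part B — `stripMaxPrinciple_holds : StripMaxPrinciple`, from part 1's `norm_le_of_subset_strip`, the tree's order bound
`riemannXi_order_le_one_holds` (Titchmarsh (2.12.3)) + a Cauchy estimate for `ξ′` (`exists_norm_riemannXi_and_deriv_le`,
`exists_norm_lagariasE_le_exp_exp`: `‖E_ξ(z)‖ ≤ exp (B e^{2‖z‖})`, `norm_lagariasTheta_le_of_sphere`), and the tree's removable-singularity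
germ of `Θ_ξ` at real points (`exists_ball_lagariasTheta_control`; the continuous extension `thetaTilde` — the ONE auxiliary definition of
this file, data-valued).  Consequently `zeroFreeDoor_of_minModulusCircles : MinModulusCircles → ZeroFreeDoor` and
`zeroFreeDoorIff_of_minModulusCircles : MinModulusCircles → (RH ↔ ∀ z, 0 < Im z → E_ξ z ≠ 0)`.  References: E. C. Titchmarsh, *The Theory
of the Riemann Zeta-Function* Thm 2.12; *The Theory of Functions* §8.71 (minimum modulus); J. C. Lagarias, Acta Arith. 89 (1999); M. Suzuki,
CJM 2025 (arXiv:2301.00421) §2.4, §3.2.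
LABELS (seat; referee word requested 04:58:31Z): RH-FREE KERNEL THEOREMS (PL bookkeeping + order bound).
Nothing here is a claim about the truth of RH; the door `RH ⟺ E_ξ zero-free on ℂ₊` stays RH-EQUIVALENT (and conditional on the textbook input `MinModulusCircles`).
-/

noncomputable section

-- D-0017: `Summit.<S>.<S>.…` is the designed namespace of a single-problem summit.
set_option linter.dupNamespace false

open Set Filter Metric Complex Bornology Topology
open scoped ComplexConjugate
open Literature.NumberTheory.LFunctions Literature.Analysis.DeBrangesSpaces
open Summit.RiemannHypothesis.RiemannHypothesis.Theorems.LagariasZeroFreeDoor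

namespace Summit.RiemannHypothesis.RiemannHypothesis.Theorems.LagariasZeroFreeDoorStrip

/-! ## Part B — the tree's `StripMaxPrinciple` proved -/

/-- RH-FREE.  Order-type bound for `ξ` AND `ξ′` with common constants: `‖ξ(s)‖, ‖ξ′(s)‖ ≤ C·exp (A(‖s‖+1) log (2+‖s‖))`
(the tree's `riemannXi_order_le_one_holds`, Titchmarsh (2.12.3), plus the Cauchy estimate on the unit circle). -/
theorem exists_norm_riemannXi_and_deriv_le : ∃ A C : ℝ, 0 ≤ A ∧ 0 ≤ C ∧ ∀ s : ℂ,
    ‖riemannXi s‖ ≤ C * Real.exp (A * (‖s‖ + 1) * Real.log (2 + ‖s‖)) ∧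
    ‖deriv riemannXi s‖ ≤ C * Real.exp (A * (‖s‖ + 1) * Real.log (2 + ‖s‖)) := by
  obtain ⟨A, C, hA, hC, h⟩ := riemannXi_order_le_one_holds.nonneg
  have hmono : ∀ s u : ℂ, ‖u‖ ≤ ‖s‖ + 1 →
      ‖riemannXi u‖ ≤ C * Real.exp (A * (‖s‖ + 1) * Real.log (2 + ‖s‖)) := by
    intro s u hu
    refine (h u).trans (mul_le_mul_of_nonneg_left (Real.exp_le_exp.2 ?_) hC)
    have hlog : Real.log (1 + ‖u‖) ≤ Real.log (2 + ‖s‖) :=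
      Real.log_le_log (by positivity) (by linarith)
    have hlog0 : 0 ≤ Real.log (1 + ‖u‖) := Real.log_nonneg (by linarith [norm_nonneg u])
    calc A * ‖u‖ * Real.log (1 + ‖u‖) ≤ A * (‖s‖ + 1) * Real.log (1 + ‖u‖) :=
          mul_le_mul_of_nonneg_right (mul_le_mul_of_nonneg_left hu hA) hlog0
      _ ≤ A * (‖s‖ + 1) * Real.log (2 + ‖s‖) :=
          mul_le_mul_of_nonneg_left hlog (by positivity)
  refine ⟨A, C, hA, hC, fun s => ⟨hmono s s (by linarith), ?_⟩⟩
  have hd : DiffContOnCl ℂ riemannXi (ball s 1) := differentiable_riemannXi.diffContOnCl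
  have hsph : ∀ u ∈ sphere s 1, ‖riemannXi u‖ ≤ C * Real.exp (A * (‖s‖ + 1) * Real.log (2 + ‖s‖)) := by
    intro u hu
    refine hmono s u ?_
    rw [mem_sphere_iff_norm] at hu
    calc ‖u‖ = ‖(u - s) + s‖ := by rw [sub_add_cancel]
      _ ≤ ‖u - s‖ + ‖s‖ := norm_add_le _ _
      _ = ‖s‖ + 1 := by rw [hu]; ring
  have := norm_deriv_le_of_forall_mem_sphere_norm_le one_pos hd hsph
  rwa [div_one] at this

/-- RH-FREE.  Double-exponential majorant for Lagarias' `E_ξ(z) = ξ(½ − iz) + ξ′(½ − iz)`: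
`‖E_ξ(z)‖ ≤ exp (B·e^{2‖z‖})` — far inside what Phragmén–Lindelöf tolerates on a strip of width `½` (`e^{c‖z‖}`,
any `c < 2π`).  From `exists_norm_riemannXi_and_deriv_le`, `log (2+N) ≤ N+1 ≤ e^N`. -/
theorem exists_norm_lagariasE_le_exp_exp :
    ∃ B : ℝ, 0 ≤ B ∧ ∀ z : ℂ, ‖lagariasE z‖ ≤ Real.exp (B * Real.exp (2 * ‖z‖)) := by
  obtain ⟨A, C, hA, hC, h⟩ := exists_norm_riemannXi_and_deriv_le
  refine ⟨A * Real.exp 1 + 2 * C, by positivity, fun z => ?_⟩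
  set s : ℂ := 1 / 2 - I * z with hs
  set N : ℝ := ‖s‖ with hN
  have hN0 : 0 ≤ N := norm_nonneg _
  have hNz : N ≤ ‖z‖ + 1 / 2 := by
    rw [hN, hs]
    calc ‖(1 : ℂ) / 2 - I * z‖ ≤ ‖(1 : ℂ) / 2‖ + ‖I * z‖ := norm_sub_le _ _
      _ = ‖z‖ + 1 / 2 := by
          rw [norm_mul, Complex.norm_I, one_mul]
          have : ‖(1 : ℂ) / 2‖ = 1 / 2 := by
            rw [norm_div, norm_one, Complex.norm_two]
          rw [this]; ring
  have hexp : A * (N + 1) * Real.log (2 + N) ≤ A * Real.exp 1 * Real.exp (2 * ‖z‖) := by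
    have hlog : Real.log (2 + N) ≤ N + 1 := by
      have := Real.log_le_sub_one_of_pos (by linarith : (0 : ℝ) < 2 + N); linarith
    have hN1 : N + 1 ≤ Real.exp N := Real.add_one_le_exp N
    calc A * (N + 1) * Real.log (2 + N) ≤ A * (N + 1) * (N + 1) :=
          mul_le_mul_of_nonneg_left hlog (by positivity)
      _ ≤ A * (Real.exp N * Real.exp N) := by
          rw [mul_assoc]
          exact mul_le_mul_of_nonneg_left
            (mul_le_mul hN1 hN1 (by positivity) (Real.exp_pos _).le) hA
      _ = A * Real.exp (2 * N) := by rw [← Real.exp_add]; ring_nf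
      _ ≤ A * Real.exp (1 + 2 * ‖z‖) := by gcongr; linarith
      _ = A * Real.exp 1 * Real.exp (2 * ‖z‖) := by rw [Real.exp_add]; ring
  have hE : ‖lagariasE z‖ ≤ 2 * C * Real.exp (A * Real.exp 1 * Real.exp (2 * ‖z‖)) := by
    have e1 : C * Real.exp (A * (N + 1) * Real.log (2 + N)) ≤
        C * Real.exp (A * Real.exp 1 * Real.exp (2 * ‖z‖)) :=
      mul_le_mul_of_nonneg_left (Real.exp_le_exp.2 hexp) hC
    have h1 := (h s).1
    have h2 := (h s).2
    calc ‖lagariasE z‖ = ‖riemannXi s + deriv riemannXi s‖ := rfl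
      _ ≤ ‖riemannXi s‖ + ‖deriv riemannXi s‖ := norm_add_le _ _
      _ ≤ 2 * C * Real.exp (A * Real.exp 1 * Real.exp (2 * ‖z‖)) := by linarith
  have h2C : 2 * C ≤ Real.exp (2 * C * Real.exp (2 * ‖z‖)) := by
    have h1 : (1 : ℝ) ≤ Real.exp (2 * ‖z‖) := Real.one_le_exp (by positivity)
    have h3 : 2 * C ≤ 2 * C * Real.exp (2 * ‖z‖) := by nlinarith
    linarith [Real.add_one_le_exp (2 * C * Real.exp (2 * ‖z‖))]
  calc ‖lagariasE z‖ ≤ 2 * C * Real.exp (A * Real.exp 1 * Real.exp (2 * ‖z‖)) := hE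
    _ ≤ Real.exp (2 * C * Real.exp (2 * ‖z‖)) * Real.exp (A * Real.exp 1 * Real.exp (2 * ‖z‖)) :=
        mul_le_mul_of_nonneg_right h2C (Real.exp_pos _).le
    _ = Real.exp ((A * Real.exp 1 + 2 * C) * Real.exp (2 * ‖z‖)) := by rw [← Real.exp_add]; ring_nf

/-- RH-FREE.  On a minimum-modulus circle `‖z‖ = r` (`|E_ξ| ≥ e^{−r²}` there, i.e. `MinModulusCircles` at `ε = 1`)
the quotient `Θ_ξ = E♯/E` is at most `exp ((B+1) e^{2r})` off the zeros of `E_ξ`. -/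
theorem norm_lagariasTheta_le_of_sphere {B r : ℝ}
    (hB : ∀ z : ℂ, ‖lagariasE z‖ ≤ Real.exp (B * Real.exp (2 * ‖z‖)))
    (hmin : ∀ z : ℂ, ‖z‖ = r → Real.exp (-(r ^ ((1 : ℝ) + 1))) ≤ ‖lagariasE z‖)
    {z : ℂ} (hz : ‖z‖ = r) (hE : lagariasE z ≠ 0) :
    ‖lagariasTheta z‖ ≤ Real.exp ((B + 1) * Real.exp (2 * r)) := by
  have hr0 : 0 ≤ r := hz ▸ norm_nonneg z
  have hlow : Real.exp (-(r ^ 2)) ≤ ‖lagariasE z‖ := by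
    have := hmin z hz
    rwa [show (1 : ℝ) + 1 = 2 by norm_num, Real.rpow_two] at this
  have hup : ‖sharp lagariasE z‖ ≤ Real.exp (B * Real.exp (2 * r)) := by
    rw [norm_sharp]
    have := hB (conj z)
    rwa [Complex.norm_conj, hz] at this
  have hEpos : 0 < ‖lagariasE z‖ := norm_pos_iff.2 hE
  have hsq : r ^ 2 ≤ Real.exp (2 * r) := by
    have h1 : r ≤ Real.exp r := by linarith [Real.add_one_le_exp r]
    have h2 : r ^ 2 ≤ Real.exp r ^ 2 := pow_le_pow_left₀ hr0 h1 2
    have h3 : Real.exp r ^ 2 = Real.exp (2 * r) := by rw [← Real.exp_nat_mul]; norm_num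
    linarith
  show ‖sharp lagariasE z / lagariasE z‖ ≤ _
  rw [norm_div, div_le_iff₀ hEpos]
  calc ‖sharp lagariasE z‖ ≤ Real.exp (B * Real.exp (2 * r)) := hup
    _ = Real.exp ((B + 1) * Real.exp (2 * r)) * Real.exp (-(Real.exp (2 * r))) := by
        rw [← Real.exp_add]; ring_nf
    _ ≤ Real.exp ((B + 1) * Real.exp (2 * r)) * Real.exp (-(r ^ 2)) :=
        mul_le_mul_of_nonneg_left (Real.exp_le_exp.2 (neg_le_neg hsq)) (Real.exp_pos _).le
    _ ≤ Real.exp ((B + 1) * Real.exp (2 * r)) * ‖lagariasE z‖ :=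
        mul_le_mul_of_nonneg_left hlow (Real.exp_pos _).le

/-- RH-FREE.  The continuous extension of `Θ_ξ` across the (removable) real zeros of `E_ξ`: at a zero of `E_ξ` the
punctured limit, elsewhere `Θ_ξ` itself.  (Only its values on the CLOSED upper half-plane matter below.) -/
def thetaTilde (z : ℂ) : ℂ :=
  if lagariasE z = 0 then limUnder (𝓝[≠] z) lagariasTheta else lagariasTheta z

/-- `Θ̃ = Θ_ξ` off the zeros of `E_ξ`. -/
theorem thetaTilde_eq_of_ne {z : ℂ} (h : lagariasE z ≠ 0) : thetaTilde z = lagariasTheta z := if_neg h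

/-- RH-FREE.  At every real point `x₀`, `Θ̃` coincides on a whole ball with the tree's analytic germ `q` of `Θ_ξ`
(`exists_ball_lagariasTheta_control`), and `‖q x₀‖ = 1` by the reflection identity `q(ū)·conj q(u) = 1`. -/
theorem thetaTilde_eqOn_ball (x₀ : ℝ) : ∃ q : ℂ → ℂ, ∃ r > (0 : ℝ),
    (∀ u ∈ ball (x₀ : ℂ) r, DifferentiableAt ℂ q u) ∧
    (∀ u ∈ ball (x₀ : ℂ) r, thetaTilde u = q u) ∧ ‖q x₀‖ = 1 := by
  obtain ⟨q, r, hr, M, -, hqd, -, -, hΘq, hrefl⟩ := exists_ball_lagariasTheta_control x₀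
  refine ⟨q, r, hr, hqd, fun u hu => ?_, ?_⟩
  · have hev : ∀ᶠ v in 𝓝[≠] u, v ∈ ball (x₀ : ℂ) r ∧ v ≠ (x₀ : ℂ) := by
      by_cases hux : u = (x₀ : ℂ)
      · subst hux
        exact ((eventually_nhdsWithin_of_eventually_nhds (isOpen_ball.eventually_mem hu)).and
          eventually_mem_nhdsWithin).mono fun v hv => ⟨hv.1, hv.2⟩
      · exact eventually_nhdsWithin_of_eventually_nhds
          (((isOpen_ball.eventually_mem hu).and (isOpen_ne.eventually_mem hux)).mono
            fun v hv => ⟨hv.1, hv.2⟩)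
    have hqu : Tendsto q (𝓝[≠] u) (𝓝 (q u)) :=
      (hqd u hu).continuousAt.tendsto.mono_left nhdsWithin_le_nhds
    have hΘu : Tendsto lagariasTheta (𝓝[≠] u) (𝓝 (q u)) :=
      hqu.congr' (hev.mono fun v hv => (hΘq v hv.1 hv.2).symm)
    by_cases hE : lagariasE u = 0
    · rw [thetaTilde, if_pos hE]
      exact hΘu.limUnder_eq
    · rw [thetaTilde, if_neg hE]
      have hΘ : lagariasTheta = fun z ↦ sharp lagariasE z / lagariasE z := rfl
      have hΘc : ContinuousAt lagariasTheta u := by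
        rw [hΘ]
        exact ((differentiable_sharp differentiable_lagariasE).continuous.continuousAt).div
          continuous_lagariasE.continuousAt hE
      exact tendsto_nhds_unique (hΘc.tendsto.mono_left nhdsWithin_le_nhds) hΘu
  · have h := hrefl (x₀ : ℂ) (mem_ball_self hr)
    rw [Complex.conj_ofReal] at h
    have h2 : ‖q x₀‖ ^ 2 = 1 := by
      have := congrArg (fun w : ℂ => ‖w‖) h
      simpa [norm_mul, Complex.norm_conj, sq] using this
    exact (pow_eq_one_iff_of_nonneg (norm_nonneg _) two_ne_zero).1 h2

/-- **RH-FREE.  The tree's typed input `StripMaxPrinciple` (Theorems/LagariasZeroFreeDoor.lean) is a THEOREM.**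
Under its own antecedents (`E_ξ` zero-free on `0 < Im z < ½`, `|Θ_ξ| ≤ 1` on `Im z = ½`, `MinModulusCircles`):
`|Θ_ξ| ≤ 1` on the strip — by Part A applied to the continuous extension `Θ̃` on `U = {0 < Im z < ½}`, with the
circle growth from `exists_norm_lagariasE_le_exp_exp` + the minimum-modulus circles (`ε = 1`). -/
theorem stripMaxPrinciple_holds : StripMaxPrinciple := by
  intro hzf htop hmin z hz0 hz1
  have hne : ∀ w : ℂ, 0 < w.im → lagariasE w ≠ 0 := fun w hw => by
    rcases lt_or_ge w.im (1 / 2) with h | h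
    · exact hzf w hw h
    · exact (cayleyHalfPlaneControl w h).1
  obtain ⟨B, -, hB⟩ := exists_norm_lagariasE_le_exp_exp
  set U : Set ℂ := im ⁻¹' Ioo 0 (1 / 2) with hU
  have hopen : IsOpen {w : ℂ | 0 < w.im} := isOpen_lt continuous_const continuous_im
  have heq : EqOn lagariasTheta thetaTilde {w : ℂ | 0 < w.im} :=
    fun w hw => (thetaTilde_eq_of_ne (hne w hw)).symm
  have hΘ : lagariasTheta = fun z ↦ sharp lagariasE z / lagariasE z := rfl
  have hΘdiff : DifferentiableOn ℂ lagariasTheta {w : ℂ | 0 < w.im} := by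
    rw [hΘ]
    exact (differentiable_sharp differentiable_lagariasE).differentiableOn.div
      differentiable_lagariasE.differentiableOn fun w hw => hne w hw
  have hTdiff : DifferentiableOn ℂ thetaTilde {w : ℂ | 0 < w.im} := hΘdiff.congr fun w hw => (heq hw).symm
  have hTcont : ∀ w : ℂ, 0 ≤ w.im → ContinuousAt thetaTilde w := by
    intro w hw
    rcases hw.lt_or_eq with hw | hw
    · exact (hTdiff.differentiableAt (hopen.mem_nhds hw)).continuousAt
    · have hwre : w = ((w.re : ℝ) : ℂ) := by
        apply Complex.ext <;> simp [hw.symm]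
      obtain ⟨q, r, hr, hqd, hqeq, -⟩ := thetaTilde_eqOn_ball w.re
      rw [hwre]
      have hq : ContinuousAt q (w.re : ℂ) := (hqd _ (mem_ball_self hr)).continuousAt
      exact hq.congr (Filter.eventuallyEq_of_mem (isOpen_ball.mem_nhds (mem_ball_self hr))
        fun u hu => (hqeq u hu).symm)
  have hd : DiffContOnCl ℂ thetaTilde U := by
    refine ⟨hTdiff.mono fun w hw => hw.1, ?_⟩
    rw [hU, closure_preimage_im, closure_Ioo (by norm_num : (0 : ℝ) ≠ 1 / 2)]
    exact fun w hw => (hTcont w hw.1).continuousWithinAt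
  have hfr : ∀ w ∈ frontier U, ‖thetaTilde w‖ ≤ 1 := by
    intro w hw
    rw [hU, frontier_preimage_im, frontier_Ioo (by norm_num : (0 : ℝ) < 1 / 2)] at hw
    simp only [mem_preimage, mem_insert_iff, mem_singleton_iff] at hw
    rcases hw with hw | hw
    · have hwre : w = ((w.re : ℝ) : ℂ) := by
        apply Complex.ext <;> simp [hw]
      obtain ⟨q, r, hr, -, hqeq, hq1⟩ := thetaTilde_eqOn_ball w.re
      rw [hwre, hqeq _ (mem_ball_self hr), hq1]
    · rw [thetaTilde_eq_of_ne (hne w (by rw [hw]; norm_num))]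
      exact htop w hw
  have hgr : ∃ c < Real.pi / (1 / 2 - 0), ∃ B' : ℝ, ∀ R₀ : ℝ, ∃ R : ℝ, R₀ ≤ R ∧
      ∀ w ∈ U, ‖w‖ = R → ‖thetaTilde w‖ ≤ Real.exp (B' * Real.exp (c * R)) := by
    refine ⟨2, ?_, B + 1, fun R₀ => ?_⟩
    · rw [sub_zero, lt_div_iff₀ (by norm_num : (0 : ℝ) < 1 / 2)]
      linarith [Real.pi_gt_three]
    · obtain ⟨r, hr, hmr⟩ := hmin 1 one_pos R₀
      refine ⟨r, hr, fun w hw hwr => ?_⟩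
      rw [thetaTilde_eq_of_ne (hne w hw.1)]
      exact norm_lagariasTheta_le_of_sphere hB hmr hwr (hne w hw.1)
  have hzU : z ∈ closure U := subset_closure (show z ∈ U from ⟨hz0, hz1⟩)
  have key := norm_le_of_subset_strip (by norm_num : (0 : ℝ) < 1 / 2) subset_rfl hd hfr hgr hzU
  rwa [thetaTilde_eq_of_ne (hne z hz0)] at key

/-- RH-FREE bookkeeping.  The zero-free door now needs ONE textbook input (Hadamard–Littlewood minimum modulus for the
order-1 entire function `E_ξ`) instead of two: `MinModulusCircles → (E_ξ zero-free on ℂ₊ → RH)`. -/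
theorem zeroFreeDoor_of_minModulusCircles (hmin : MinModulusCircles) : ZeroFreeDoor :=
  zeroFreeDoor_of hmin stripMaxPrinciple_holds

/-- RH-FREE bookkeeping.  `MinModulusCircles → (RH ↔ E_ξ zero-free on ℂ₊)`; the equivalence is RH-EQUIVALENT by
construction and certifies nothing about RH. -/
theorem zeroFreeDoorIff_of_minModulusCircles (hmin : MinModulusCircles) :
    RiemannHypothesis ↔ ∀ z : ℂ, 0 < z.im → lagariasE z ≠ 0 :=
  zeroFreeDoorIff_of hmin stripMaxPrinciple_holds

end Summit.RiemannHypothesis.RiemannHypothesis.Theorems.LagariasZeroFreeDoorStrip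

end
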